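import Mathlib
import HarnessLib
import Summits.ResolutionOfSingularities.ResolutionOfSingularities.Theorems.WildQuotientsWildQuotientResolutionAffineQuotientModelTransfer
import Summits.ResolutionOfSingularities.ResolutionOfSingularities.Theorems.WildQuotientsWildQuotientResolutionBlowupExitIsolatedBlowupGlue
import Summits.ResolutionOfSingularities.ResolutionOfSingularities.Theorems.WildQuotientsWildQuotientResolutionConductorOnePieceBrick
import Summits.ResolutionOfSingularities.ResolutionOfSingularities.Theorems.WildQuotientsWildQuotientResolutionConductorOneCoreModel
import Summits.ResolutionOfSingularities.ResolutionOfSingularities.Theorems.WildQuotientsWildQuotientResolutionConductorOneCoreQuotMap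
import Summits.ResolutionOfSingularities.ResolutionOfSingularities.Theorems.WildQuotientsWildQuotientResolutionConductorOneToricFanExtras

/-!
# S2 F8 — THE SCAFFOLD of the conductor-𝟙 core: `HasResolution (Spec (CoreRing k p n)^σ)` from the frame brick HF and the toric brick HT
(crux stmt-ResolutionOfSingularities-15640 `WildQuotients.WildQuotientResolution`, line `Sketch`; chain w45c
post-V5 programme S2 = `ConductorOneCore p n` (all `n ≥ 1`, all `p`), design `L/res-L1-w45c-lead-1/S2-DESIGN.md`
v1.1 §4/§5, res-L1-w45c-plan-1 RULINGs 2026-08-27T16:27:51Z / 17:07:17Z / 17:31:45Z; SIG pin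
`L/res-L1-w45c-lead-1/stubs/ConductorOneF8Sig.lean`. [OURS · L1 W4.5c] — NOT a statement of the manuscript;
AI-produced architecture, kernel-checked ≠ expert-reviewed. Lead prover res-L1-w45c-lead-1.)

`ConductorOne.conductorOneCore_hasResolution_of_bricks`: for the conductor-𝟙 automorphism `σ` of
`CoreRing k p n` (`σ(uᵢ)(1+uᵢ) = uᵢ`), GIVEN
* **HF** (frame, res-D-pv-033's F3): an equivariant proper birational integral model `V → Spec CoreRing` with
  the lifted `⟨σ⟩`-action over `Spec CoreRing^σ`, stable affine pieces `O I` (`∅ ≠ I ⊆ {1..n}`) covering `V`,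
  seams `e I hI : Γ(O I) ≃+* ChartRing k p n (min I) I` with a `k`-algebra endomorphism `τ I hI` of the chart
  ring satisfying the diagonal-Möbius laws and cutting out the invariants, and the boolean-point separation;
* **HT** (toric, res-L1-w45c-stub-4's F6 `ConductorOne.toricBrick_full`): for every `I ≠ ∅` an ideal `J₀ ≠ ⊥`
  of the weight-`0` cone with `√J₀ =` irrelevant and `Bl_{J₀}` regular;
THEN `Spec (CoreRing k p n)^σ` has a resolution of singularities. The presentation brick HP is CONSUMED
INSIDE (landed F5 `ConductorOne.presentation`, via `ConductorOne.exists_pieceCentre`). Assembly: G2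
`AffineQuotient.hasResolution_spec_fixedPoints_of_model` ∘ lemma G `BlowupExit.hasResolution_of_isolated_local_blowups`
on the quotient pieces `(O I)/G ↪ V/G`, the per-piece centres transported along `(O I)/G ≅ range`, the
isolation from the boolean-point separation through `π⁻¹((O J)/G) = O J` and closedness of `π : V → V/G`.
-/

-- single-problem summit: the doubled namespace component `ResolutionOfSingularities` is forced
set_option linter.dupNamespace false

noncomputable section

open CategoryTheory AlgebraicGeometry TopologicalSpace MvPolynomial
open Literature.AlgebraicGeometry.Resolution Literature.AlgebraicGeometry.RelativeSpec

namespace Summit.ResolutionOfSingularities.ResolutionOfSingularities.Theorems.WildQuotientResolution.ConductorOne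

/-- Transport of a local centre along an isomorphism of schemes, with its blow-up and support. [folklore] -/
theorem exists_idealSheaf_transport {P Q : Scheme.{0}} (φ : P ≅ Q) (𝔞 : P.IdealSheafData) (h0 : 𝔞 ≠ ⊥)
    (hbl : ∃ (B : Scheme.{0}) (pB : B ⟶ P), IsBlowup pB 𝔞 ∧ Scheme.IsRegular B) :
    ∃ 𝔞' : Q.IdealSheafData, 𝔞' ≠ ⊥ ∧
      (∃ (B : Scheme.{0}) (pB : B ⟶ Q), IsBlowup pB 𝔞' ∧ Scheme.IsRegular B) ∧
      ((𝔞'.support : Set Q) = φ.hom.base '' (𝔞.support : Set P)) := by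
  refine ⟨𝔞.comap φ.inv, ?_, ?_, ?_⟩
  · intro h
    have h' := congrArg (fun 𝔟 => Scheme.IdealSheafData.comap 𝔟 φ.hom) h
    simp only [← Scheme.IdealSheafData.comap_comp, Iso.hom_inv_id, Scheme.IdealSheafData.comap_id,
      Scheme.IdealSheafData.comap_bot] at h'
    exact h0 h'
  · obtain ⟨B, pB, hpB, hreg⟩ := hbl
    exact ⟨B, pB ≫ φ.hom, hpB.comp_iso φ, hreg⟩
  · rw [Scheme.IdealSheafData.support_comap, Closeds.coe_preimage]
    ext y
    constructor
    · intro hy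
      refine ⟨φ.inv.base y, hy, ?_⟩
      change (φ.inv ≫ φ.hom).base y = y
      rw [Iso.inv_hom_id]; rfl
    · rintro ⟨x, hx, rfl⟩
      change (φ.hom ≫ φ.inv).base x ∈ (𝔞.support : Set P)
      rw [Iso.hom_inv_id]; exact hx

/-- **The local centre on a quotient piece `O/G ↪ X/G`** (per-piece brick `exists_pieceCentre` transported
along `O/G ≅ range (O/G ↪ X/G)`), with its support written as the image under `π : X → X/G` of the boolean
zero locus. [OURS · L1 W4.5c] -/
theorem exists_quotPieceCentre {X S : Scheme.{0}} {r : X ⟶ S}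
    {G : Type} [Group G] [Finite G] (ρ : ActionOver r G) [S.IsSeparated] [IsSeparated r]
    [IsAffine S] (hcov : ∀ x : X, ∃ O : ρ.StableAffineOpens, x ∈ O.1) (O : ρ.StableAffineOpens)
    (k : Type) [Field k] (p n : ℕ) (i : Fin n) (I : Finset (Fin n)) [Fact p.Prime] [CharP k p]
    (hi : i ∈ I)
    (e : Γ((O.1 : Scheme.{0}), (O.1.ι ≫ r) ⁻¹ᵁ ⊤) ≃+* ChartRing k p n i I)
    (τ : ChartRing k p n i I →ₐ[k] ChartRing k p n i I)
    (hτ : IsChartAction k p n i I (τ : ChartRing k p n i I →+* ChartRing k p n i I))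
    (hinv : ∀ x, x ∈ (ρ.restrict O.1 O.2.1).invariantsRing ⊤ ↔ τ (e x) = e x)
    (J₀ : Ideal (PthCone.cone k n p (chartWeight p n I))) (hJ0 : J₀ ≠ ⊥)
    (hrad : J₀.radical = PthCone.irrelevant k n p (chartWeight p n I))
    (hreg : Scheme.IsRegular (affineBlowup J₀)) :
    ∃ 𝔞 : (((ρ.gluedι O).opensRange : ρ.glued.Opens) : Scheme.{0}).IdealSheafData,
      𝔞 ≠ ⊥ ∧
      (∃ (B : Scheme.{0}) (pB : B ⟶ ((ρ.gluedι O).opensRange : ρ.glued.Opens)),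
        IsBlowup pB 𝔞 ∧ Scheme.IsRegular B) ∧
      ((ρ.gluedι O).opensRange.ι.base '' (𝔞.support : Set _) =
        (ρ.gluedMk hcov).base '' (O.1.ι.base '' ((O.1 : Scheme.{0}).zeroLocus
          ((e.symm : ChartRing k p n i I → _) '' Set.range (chartX k p n i I))))) := by
  obtain ⟨𝔞, h𝔞0, hbl, hsupp⟩ :=
    exists_pieceCentre ρ O k p n i I hi e τ hτ hinv J₀ hJ0 hrad hreg
  let φ : ρ.pieceQuot O ≅ (((ρ.gluedι O).opensRange : ρ.glued.Opens) : Scheme.{0}) :=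
    (ρ.gluedι O).isoOpensRange
  obtain ⟨𝔞', h𝔞'0, hbl', hsupp'⟩ := exists_idealSheaf_transport φ 𝔞 h𝔞0 hbl
  refine ⟨𝔞', h𝔞'0, hbl', ?_⟩
  have key : ∀ x : (O.1 : Scheme.{0}),
      (ρ.gluedι O).opensRange.ι.base (φ.hom.base ((ρ.pieceMk O).base x)) =
        (ρ.gluedMk hcov).base (O.1.ι.base x) := fun x => by
    change (ρ.pieceMk O ≫ φ.hom ≫ (ρ.gluedι O).opensRange.ι).base x = (O.1.ι ≫ ρ.gluedMk hcov).base x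
    rw [Scheme.Hom.isoOpensRange_hom_ι, ρ.ι_gluedMk hcov O]
  rw [hsupp', hsupp, Set.image_image, Set.image_image, Set.image_image]
  exact Set.image_congr' fun x => key x

/-- **Isolation transfer**: if the closed set... rather, if `T ⊆ X` misses the stable open `O`, then the closure of
`π(T)` misses `O/G ↪ X/G` (`π` closed, `π⁻¹(O/G) = O`). [OURS · L1 W4.5c] -/
theorem disjoint_closure_image_gluedMk {X S : Scheme.{0}} {r : X ⟶ S}
    {G : Type} [Group G] [Finite G] (ρ : ActionOver r G) [S.IsSeparated] [IsSeparated r]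
    (hcov : ∀ x : X, ∃ O : ρ.StableAffineOpens, x ∈ O.1) [UniversallyClosed (ρ.gluedMk hcov)]
    (O : ρ.StableAffineOpens) (T : Set X) (hT : Disjoint (O.1 : Set X) T) :
    Disjoint (((ρ.gluedι O).opensRange : ρ.glued.Opens) : Set ρ.glued)
      (closure ((ρ.gluedMk hcov).base '' T)) := by
  have hclosed : IsClosedMap (ρ.gluedMk hcov).base := (ρ.gluedMk hcov).isClosedMap
  have hT' : Disjoint (O.1 : Set X) (closure T) := hT.closure_right O.1.isOpen
  refine Set.disjoint_left.mpr fun y hyU hycl => ?_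
  obtain ⟨x, hxT, rfl⟩ := hclosed.closure_image_subset _ hycl
  have hxO : x ∈ O.1 := by
    have : x ∈ ρ.gluedMk hcov ⁻¹ᵁ (ρ.gluedι O).opensRange := hyU
    rwa [ρ.preimage_opensRange_gluedι hcov O] at this
  exact Set.disjoint_left.mp hT' hxO hxT

/-- Isolation in the form consumed by lemma G: from the support identity of a quotient-piece centre.
[OURS · L1 W4.5c] -/
theorem disjoint_closure_of_support_eq {X S : Scheme.{0}} {r : X ⟶ S}
    {G : Type} [Group G] [Finite G] (ρ : ActionOver r G) [S.IsSeparated] [IsSeparated r]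
    (hcov : ∀ x : X, ∃ O : ρ.StableAffineOpens, x ∈ O.1) [UniversallyClosed (ρ.gluedMk hcov)]
    (O O' : ρ.StableAffineOpens)
    (𝔞 : (((ρ.gluedι O).opensRange : ρ.glued.Opens) : Scheme.{0}).IdealSheafData) (T : Set X)
    (hsupp : (ρ.gluedι O).opensRange.ι.base '' (𝔞.support : Set _) = (ρ.gluedMk hcov).base '' T)
    (hT : Disjoint (O'.1 : Set X) T) :
    Disjoint (((ρ.gluedι O').opensRange : ρ.glued.Opens) : Set ρ.glued)
      (closure ((ρ.gluedι O).opensRange.ι.base '' (𝔞.support : Set _))) := by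
  rw [hsupp]
  exact disjoint_closure_image_gluedMk ρ hcov O' T hT

/-- **S2 SCAFFOLD (F8).** See the module docstring. [OURS · L1 W4.5c] -/
theorem conductorOneCore_hasResolution_of_bricks (p : ℕ) (hp : p.Prime) (k : Type) [Field k] [CharP k p]
    (n : ℕ) (hn : 1 ≤ n) (σ : CoreRing k p n ≃ₐ[k] CoreRing k p n)
    (hσ : ∀ i, σ (coreU k p n i) * (1 + coreU k p n i) = coreU k p n i)
    (HF : ∃ (ρ : ↥(Subgroup.zpowers σ) →* Aut (Spec (CommRingCat.of (CoreRing k p n))))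
        (_ : ∀ g : ↥(Subgroup.zpowers σ), (ρ g).hom = Spec.map (CommRingCat.ofHom
          ((MulSemiringAction.toRingEquiv (↥(Subgroup.zpowers σ)) (CoreRing k p n) g⁻¹ :
            CoreRing k p n ≃+* CoreRing k p n) : CoreRing k p n →+* CoreRing k p n)))
        (V : Scheme.{0}) (π : V ⟶ Spec (CommRingCat.of (CoreRing k p n))) (_ : IsProper π)
        (_ : IsBirational π) (_ : IsIntegral V)
        (ρB : ActionOver (π ≫ coreQuotMap k p n σ) ↥(Subgroup.zpowers σ))
        (_ : ∀ g : ↥(Subgroup.zpowers σ), (ρB.aut g).hom ≫ π = π ≫ (ρ g).hom)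
        (O : {I : Finset (Fin n) // I.Nonempty} → ρB.StableAffineOpens)
        (_ : ⨆ I, (O I).1 = ⊤)
        (e : ∀ (I : Finset (Fin n)) (hI : I.Nonempty),
          Γ(((O ⟨I, hI⟩).1 : Scheme.{0}), ((O ⟨I, hI⟩).1.ι ≫ (π ≫ coreQuotMap k p n σ)) ⁻¹ᵁ ⊤) ≃+*
            ChartRing k p n (I.min' hI) I)
        (τ : ∀ (I : Finset (Fin n)) (hI : I.Nonempty),
          ChartRing k p n (I.min' hI) I →ₐ[k] ChartRing k p n (I.min' hI) I)
        (_ : ∀ (I : Finset (Fin n)) (hI : I.Nonempty), IsChartAction k p n (I.min' hI) I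
          (τ I hI : ChartRing k p n (I.min' hI) I →+* ChartRing k p n (I.min' hI) I))
        (_ : ∀ (I : Finset (Fin n)) (hI : I.Nonempty) (x),
          x ∈ (ρB.restrict (O ⟨I, hI⟩).1 (O ⟨I, hI⟩).2.1).invariantsRing ⊤ ↔ τ I hI (e I hI x) = e I hI x),
        ∀ (I : Finset (Fin n)) (hI : I.Nonempty) (I' : Finset (Fin n)) (hI' : I'.Nonempty), I ≠ I' →
          Disjoint (((O ⟨I', hI'⟩).1 : Set V))
            ((O ⟨I, hI⟩).1.ι.base '' (((O ⟨I, hI⟩).1 : Scheme.{0}).zeroLocus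
              (((e I hI).symm : ChartRing k p n (I.min' hI) I → _) '' Set.range (chartX k p n (I.min' hI) I)))))
    (HT : ∀ I : Finset (Fin n), I.Nonempty →
      ∃ J₀ : Ideal (PthCone.cone k n p (chartWeight p n I)), J₀ ≠ ⊥ ∧
        J₀.radical = PthCone.irrelevant k n p (chartWeight p n I) ∧ Scheme.IsRegular (affineBlowup J₀)) :
    Scheme.HasResolution (Spec (CommRingCat.of
      (FixedPoints.subalgebra k (CoreRing k p n) ↥(Subgroup.zpowers σ)))) := by
  classical
  haveI : Fact p.Prime := ⟨hp⟩
  haveI : Finite ↥(Subgroup.zpowers σ) := finite_zpowers_of_law k p n σ hσ hn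
  haveI : IsDomain (CoreRing k p n) := coreRing_isDomain k p n
  haveI : Algebra.FiniteType k (CoreRing k p n) := core_finiteType k p n
  haveI : FaithfulSMul ↥(Subgroup.zpowers σ) (CoreRing k p n) := faithfulSMul_zpowers k p n σ
  obtain ⟨ρ, hρ, V, π, hprop, hbir, hint, ρB, hequiv, O, hcovO, e, τ, hτ, hinv, hsep⟩ := HF
  haveI := hprop
  haveI := hint
  have hcovI : ∀ v : V, ∃ I, v ∈ (O I).1 := fun v => by
    have hv : v ∈ (⊤ : V.Opens) := trivial
    rw [← hcovO] at hv
    exact Opens.mem_iSup.mp hv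
  have hcov : ∀ v : V, ∃ O' : ρB.StableAffineOpens, v ∈ O'.1 := fun v => by
    obtain ⟨I, hI⟩ := hcovI v
    exact ⟨O I, hI⟩
  refine AffineQuotient.hasResolution_spec_fixedPoints_of_model k (core_not_krullDim_le_zero k p n hn)
    ρ hρ V π hbir ρB hequiv hcov ?_
  /- ### The quotient `Y = V/G` is integral and locally Noetherian -/
  haveI : LocallyOfFiniteType (Spec.map (CommRingCat.ofHom (algebraMap k
      (FixedPoints.subalgebra k (CoreRing k p n) ↥(Subgroup.zpowers σ))))) :=
    AffineQuotient.locallyOfFiniteType_specMap_fixedPoints k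
  haveI : IsFinite (coreQuotMap k p n σ) := AffineQuotient.isFinite_specMap_fixedPoints k
  have hsurj : Function.Surjective (coreQuotMap k p n σ).base :=
    AffineQuotient.surjective_specMap_fixedPoints k
  have horb : ∀ x y : Spec (CommRingCat.of (CoreRing k p n)),
      (coreQuotMap k p n σ).base x = (coreQuotMap k p n σ).base y →
      ∃ g : ↥(Subgroup.zpowers σ), (ρ g).hom.base x = y :=
    fun x y hxy => AffineQuotient.exists_specAction_base_eq k ρ hρ x y hxy
  have hfaith : Function.Injective ρ := AffineQuotient.specAction_injective ρ hρ
  have hUet := AffineQuotient.exists_dense_etale_specMap_fixedPoints k (B := CoreRing k p n)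
    (G := ↥(Subgroup.zpowers σ))
  have hdim' : ¬ topologicalKrullDim (Spec (CommRingCat.of
      (FixedPoints.subalgebra k (CoreRing k p n) ↥(Subgroup.zpowers σ)))) ≤ 0 := by
    rw [AffineQuotient.topologicalKrullDim_spec_fixedPoints k]; exact core_not_krullDim_le_zero k p n hn
  obtain ⟨hYint, hYproper, -⟩ := QuotientModel.quotientModel_proper_birational k
    (Spec (CommRingCat.of (CoreRing k p n)))
    (Spec (CommRingCat.of (FixedPoints.subalgebra k (CoreRing k p n) ↥(Subgroup.zpowers σ))))
    (Spec.map (CommRingCat.ofHom (algebraMap k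
      (FixedPoints.subalgebra k (CoreRing k p n) ↥(Subgroup.zpowers σ)))))
    (coreQuotMap k p n σ) _ ρ hfaith hdim' hsurj hUet horb V π hbir ρB hequiv hcov
  haveI := hYint
  haveI := hYproper
  haveI : LocallyOfFiniteType (ρB.gluedDesc _ ρB.aut_comp ≫
      Spec.map (CommRingCat.ofHom (algebraMap k
        (FixedPoints.subalgebra k (CoreRing k p n) ↥(Subgroup.zpowers σ))))) := inferInstance
  haveI : IsLocallyNoetherian ρB.glued :=
    LocallyOfFiniteType.isLocallyNoetherian (ρB.gluedDesc _ ρB.aut_comp ≫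
      Spec.map (CommRingCat.ofHom (algebraMap k
        (FixedPoints.subalgebra k (CoreRing k p n) ↥(Subgroup.zpowers σ)))))
  /- ### The quotient pieces `(O I)/G ↪ Y`, indexed by `J = ⟨I, hI⟩` and always spelt `O ⟨J.1, J.2⟩` -/
  have hU : ⨆ J : {I : Finset (Fin n) // I.Nonempty}, (ρB.gluedι (O ⟨J.1, J.2⟩)).opensRange = ⊤ := by
    refine top_le_iff.mp fun y _ => ?_
    refine (ρB.gluedMk_surjective hcov y).elim fun v hv => ?_
    refine (hcovI v).elim fun I hvI => ?_
    refine Opens.mem_iSup.mpr ⟨I, ?_⟩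
    rw [← hv, ρB.gluedMk_apply hcov (O ⟨I.1, I.2⟩) ⟨v, hvI⟩]
    exact ⟨_, rfl⟩
  haveI hUqc : ∀ J : {I : Finset (Fin n) // I.Nonempty},
      QuasiCompact ((ρB.gluedι (O ⟨J.1, J.2⟩)).opensRange).ι := fun J => inferInstance
  /- ### The local centres and their isolation -/
  have hpiece : ∀ (I : Finset (Fin n)) (hI : I.Nonempty),
      ∃ 𝔞 : (((ρB.gluedι (O ⟨I, hI⟩)).opensRange : ρB.glued.Opens) : Scheme.{0}).IdealSheafData, 𝔞 ≠ ⊥ ∧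
        (∃ (B : Scheme.{0}) (pB : B ⟶ ((ρB.gluedι (O ⟨I, hI⟩)).opensRange : ρB.glued.Opens)),
          IsBlowup pB 𝔞 ∧ Scheme.IsRegular B) ∧
        ((ρB.gluedι (O ⟨I, hI⟩)).opensRange.ι.base '' (𝔞.support : Set _) =
          (ρB.gluedMk hcov).base '' ((O ⟨I, hI⟩).1.ι.base '' (((O ⟨I, hI⟩).1 : Scheme.{0}).zeroLocus
            (((e I hI).symm : ChartRing k p n (I.min' hI) I → _) ''
              Set.range (chartX k p n (I.min' hI) I))))) := fun I hI =>
    (HT I hI).elim fun J₀ hJ =>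
      exists_quotPieceCentre ρB hcov (O ⟨I, hI⟩) k p n (I.min' hI) I (Finset.min'_mem I hI)
        (e I hI) (τ I hI) (hτ I hI) (hinv I hI) J₀ hJ.1 hJ.2.1 hJ.2.2
  choose 𝔞 h𝔞0 h𝔞bl h𝔞supp using hpiece
  haveI : IsFinite (ρB.gluedMk hcov) := ρB.isFinite_gluedMk hcov
  exact BlowupExit.hasResolution_of_isolated_local_blowups
    (fun J : {I : Finset (Fin n) // I.Nonempty} => (ρB.gluedι (O ⟨J.1, J.2⟩)).opensRange) hU
    (fun J => 𝔞 J.1 J.2) (fun J => h𝔞0 J.1 J.2)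
    (fun J J' hJJ' => disjoint_closure_of_support_eq ρB hcov (O ⟨J.1, J.2⟩) (O ⟨J'.1, J'.2⟩) (𝔞 J.1 J.2) _
      (h𝔞supp J.1 J.2) (hsep J.1 J.2 J'.1 J'.2 (fun h => hJJ' (Subtype.ext h))))
    (fun J => h𝔞bl J.1 J.2)

/-- **S2 modulo the frame**: with the toric brick HT DISCHARGED by res-L1-w45c-stub-4's
`ConductorOne.toricBrick_full`, the resolution of the conductor-𝟙 core follows from the frame brick HF alone
(res-D-pv-033's F3). [OURS · L1 W4.5c] -/
theorem conductorOneCore_hasResolution_of_frame (p : ℕ) (hp : p.Prime) (k : Type) [Field k] [CharP k p]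
    (n : ℕ) (hn : 1 ≤ n) (σ : CoreRing k p n ≃ₐ[k] CoreRing k p n)
    (hσ : ∀ i, σ (coreU k p n i) * (1 + coreU k p n i) = coreU k p n i)
    (HF : ∃ (ρ : ↥(Subgroup.zpowers σ) →* Aut (Spec (CommRingCat.of (CoreRing k p n))))
        (_ : ∀ g : ↥(Subgroup.zpowers σ), (ρ g).hom = Spec.map (CommRingCat.ofHom
          ((MulSemiringAction.toRingEquiv (↥(Subgroup.zpowers σ)) (CoreRing k p n) g⁻¹ :
            CoreRing k p n ≃+* CoreRing k p n) : CoreRing k p n →+* CoreRing k p n)))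
        (V : Scheme.{0}) (π : V ⟶ Spec (CommRingCat.of (CoreRing k p n))) (_ : IsProper π)
        (_ : IsBirational π) (_ : IsIntegral V)
        (ρB : ActionOver (π ≫ coreQuotMap k p n σ) ↥(Subgroup.zpowers σ))
        (_ : ∀ g : ↥(Subgroup.zpowers σ), (ρB.aut g).hom ≫ π = π ≫ (ρ g).hom)
        (O : {I : Finset (Fin n) // I.Nonempty} → ρB.StableAffineOpens)
        (_ : ⨆ I, (O I).1 = ⊤)
        (e : ∀ (I : Finset (Fin n)) (hI : I.Nonempty),
          Γ(((O ⟨I, hI⟩).1 : Scheme.{0}), ((O ⟨I, hI⟩).1.ι ≫ (π ≫ coreQuotMap k p n σ)) ⁻¹ᵁ ⊤) ≃+*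
            ChartRing k p n (I.min' hI) I)
        (τ : ∀ (I : Finset (Fin n)) (hI : I.Nonempty),
          ChartRing k p n (I.min' hI) I →ₐ[k] ChartRing k p n (I.min' hI) I)
        (_ : ∀ (I : Finset (Fin n)) (hI : I.Nonempty), IsChartAction k p n (I.min' hI) I
          (τ I hI : ChartRing k p n (I.min' hI) I →+* ChartRing k p n (I.min' hI) I))
        (_ : ∀ (I : Finset (Fin n)) (hI : I.Nonempty) (x),
          x ∈ (ρB.restrict (O ⟨I, hI⟩).1 (O ⟨I, hI⟩).2.1).invariantsRing ⊤ ↔ τ I hI (e I hI x) = e I hI x),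
        ∀ (I : Finset (Fin n)) (hI : I.Nonempty) (I' : Finset (Fin n)) (hI' : I'.Nonempty), I ≠ I' →
          Disjoint (((O ⟨I', hI'⟩).1 : Set V))
            ((O ⟨I, hI⟩).1.ι.base '' (((O ⟨I, hI⟩).1 : Scheme.{0}).zeroLocus
              (((e I hI).symm : ChartRing k p n (I.min' hI) I → _) '' Set.range (chartX k p n (I.min' hI) I))))) :
    Scheme.HasResolution (Spec (CommRingCat.of
      (FixedPoints.subalgebra k (CoreRing k p n) ↥(Subgroup.zpowers σ)))) :=
  conductorOneCore_hasResolution_of_bricks p hp k n hn σ hσ HF fun I hI =>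
    (toricBrick_full p hp k n (I.min' hI) I).elim fun J₀ hJ => ⟨J₀, hJ.1, hJ.2.1, hJ.2.2.1⟩

end Summit.ResolutionOfSingularities.ResolutionOfSingularities.Theorems.WildQuotientResolution.ConductorOne

end
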